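import Summits.MatrixMultiplication.OmegaCensus.STPPKill223332332Z46AP3

/-!
# ω-census (abelian STPP census): `{(2,2,3),(3,3,2),(3,3,2)}` in `ℤ/46ℤ` — the all-progression branch is EMPTY (kernel)

HONEST FRAMING (pub-omega census; verbatim): lottery ticket; floor = certified bounds/negative ranges.
Census STRUCTURE (seat pub-omega-stpp-2 gen 32, 2026-08-30), family (b2); BRANCH I of HOME `pub-omega-stpp-2-g32/CASEMAP.md` §6, assembled:
`no_allAP_223_332_332` — there is no STPP family of the pattern in `ℤ/46ℤ` in which the progression alternatives of `blockA_structure 1/2`, `blockB_structure 1/2`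
and `blockC_structure 2` all hold.  Chain: `cross_steps_223_332_332` (`e₂ = ±d₁`, `d₂ = ±e₁`) ⇒ `grid_step_bounds` on `Y₂ ⊆ Y°₁` and `Z₂ ⊆ Z°₁`
(`δ₂ = ±k₂d₁ = ±k₂′e₁`, `3 ≤ k ≤ 9`) ⇒ `step_of_ap3_subset_13` on the rows/columns of `X₁ ⊆ X°₂` (`e₁ = ±uδ₂`, `d₁ = ±vδ₂`) ⇒ `mult_cases` (`u, v ∈ {3,4,5,6}`) ⇒
`u = v` contradicts the TPP of block `1` (`|X₁| = 9`), `u ≠ v` contradicts `window_dead_int`.  Nothing here is progress on `ω`.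

References: H. Cohn, R. Kleinberg, B. Szegedy, C. Umans, FOCS 2005 (arXiv:math/0511460), Def. 5.1; Kemperman 1960 / Kneser 1953 (through the structure files).
-/

open Finset
open scoped Pointwise

namespace Summit.MatrixMultiplication.OmegaCensus.Z46

open Literature.Computability.AlgebraicComplexity
open Literature.Combinatorics.Additive
open Summit.MatrixMultiplication.OmegaCensus.STPPKneser
open Summit.MatrixMultiplication.OmegaCensus.CubeNB

variable {A B C : Fin 3 → Finset (ZMod 46)}

/-! ## §1 Injectivity of the three difference maps (TPP of one block) -/

/-- `(b, c) ↦ c − b` is injective on `Bᵢ × Cᵢ`. [cite: CohnKleinbergSzegedyUmans2005, Def. 5.1] -/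
theorem DBC_inj (hS : IsSTPP A B C) {i : Fin 3} (hAi : (A i).Nonempty) {b b' c c' : ZMod 46} (hb : b ∈ B i) (hb' : b' ∈ B i)
    (hc : c ∈ C i) (hc' : c' ∈ C i) (h : c - b = c' - b') : b = b' ∧ c = c' := by
  obtain ⟨a, ha⟩ := hAi
  have hrel : (a - a) + (b' - b) + (c - c') = 0 := by
    have h' := sub_eq_zero.2 h; rw [← h']; abel
  obtain ⟨-, -, -, h1, h2⟩ := hS i i i a ha a ha b hb b' hb' c' hc' c hc hrel
  exact ⟨h1, h2.symm⟩

/-- `(a, c) ↦ c − a` is injective on `Aᵢ × Cᵢ`. [cite: CohnKleinbergSzegedyUmans2005, Def. 5.1] -/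
theorem DAC_inj (hS : IsSTPP A B C) {i : Fin 3} (hBi : (B i).Nonempty) {a a' c c' : ZMod 46} (ha : a ∈ A i) (ha' : a' ∈ A i)
    (hc : c ∈ C i) (hc' : c' ∈ C i) (h : c - a = c' - a') : a = a' ∧ c = c' := by
  obtain ⟨b, hb⟩ := hBi
  have hrel : (a' - a) + (b - b) + (c - c') = 0 := by
    have h' := sub_eq_zero.2 h; rw [← h']; abel
  obtain ⟨-, -, h1, -, h2⟩ := hS i i i a ha a' ha' b hb b hb c' hc' c hc hrel
  exact ⟨h1, h2.symm⟩

/-- `(a, b) ↦ b − a` is injective on `Aᵢ × Bᵢ`. [cite: CohnKleinbergSzegedyUmans2005, Def. 5.1] -/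
theorem DAB_inj (hS : IsSTPP A B C) {i : Fin 3} (hCi : (C i).Nonempty) {a a' b b' : ZMod 46} (ha : a ∈ A i) (ha' : a' ∈ A i)
    (hb : b ∈ B i) (hb' : b' ∈ B i) (h : b - a = b' - a') : a = a' ∧ b = b' := by
  obtain ⟨c, hc⟩ := hCi
  have hrel : (a' - a) + (b - b') + (c - c) = 0 := by
    have h' := sub_eq_zero.2 h; rw [← h']; abel
  obtain ⟨-, -, h1, h2, -⟩ := hS i i i a ha a' ha' b' hb' b hb c hc c hc hrel
  exact ⟨h1, h2.symm⟩

/-- Terms of a progression. [folklore] -/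
theorem mem_apFinset_of_lt {a d : ZMod 46} {n i : ℕ} (hi : i < n) : a + i • d ∈ apFinset a d n := mem_apFinset.2 ⟨i, hi, rfl⟩

/-! ## §2 The window relation in integers -/

/-- From `s + l•δ = x₀ + j•e − i•d`, `s + l₀•δ = x₀`, `e = ±u•δ`, `d = ±v•δ` (signs `su, sv`: `true` = minus), the integer sides `L•δ = R•δ`. [folklore] -/
theorem window_rel {s δ x₀ e d : ZMod 46} {l l₀ i j u v : ℕ} (su sv : Bool) (hx₀ : s + l₀ • δ = x₀) (hl : s + l • δ = x₀ + j • e - i • d)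
    (he : if su then e = -(u • δ) else e = u • δ) (hd : if sv then d = -(v • δ) else d = v • δ) :
    (l + (if sv then 0 else i * v) + (if su then j * u else 0)) • δ = (l₀ + (if su then 0 else j * u) + (if sv then i * v else 0)) • δ := by
  have key : l • δ - l₀ • δ = j • e - i • d := by
    have : (s + l • δ) - (s + l₀ • δ) = j • e - i • d := by rw [hx₀, hl]; abel
    rw [← this]; abel
  cases su <;> cases sv <;> simp only [ite_true, ite_false, Bool.false_eq_true] at he hd ⊢ <;>
    rw [he, hd] at key <;> simp only [add_nsmul, mul_nsmul', neg_nsmul, add_zero] at key ⊢ <;>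
    { have k := key; rw [sub_eq_iff_eq_add] at k; rw [k]; abel }

/-! ## §3 The all-progression branch -/

/-- **BRANCH I is empty.**  See the module docstring. [cite: CohnKleinbergSzegedyUmans2005, Def. 5.1] [cite: Kemperman1960, Thm 2.1] [cite: Kneser1953] -/
theorem no_allAP_223_332_332 (hS : IsSTPP A B C) (hA : ∀ i, #(A i) = ![2, 3, 3] i) (hB : ∀ i, #(B i) = ![2, 3, 3] i)
    (hC : ∀ i, #(C i) = ![3, 2, 2] i) {d₁ e₁ d₂ e₂ δ₂ : ZMod 46}
    (hd₁ : 2 • d₁ ≠ 0) (hA1 : IsAP (A 1) d₁) (hY1 : IsAP (DU B C (univ.erase 1)) d₁)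
    (he₁ : 2 • e₁ ≠ 0) (hB1 : IsAP (B 1) e₁) (hZ1 : IsAP (DU A C (univ.erase 1)) e₁)
    (hd₂ : 2 • d₂ ≠ 0) (hA2 : IsAP (A 2) d₂) (hY2 : IsAP (DU B C (univ.erase 2)) d₂)
    (he₂ : 2 • e₂ ≠ 0) (hB2 : IsAP (B 2) e₂) (hZ2 : IsAP (DU A C (univ.erase 2)) e₂)
    (hδ₂ : 2 • δ₂ ≠ 0) (hC2 : IsAP (C 2) δ₂) (hX2 : IsAP (DU A B (univ.erase 2)) δ₂) : False := by
  have hAne : ∀ i, (A i).Nonempty := fun i => card_pos.1 (by rw [hA]; fin_cases i <;> simp)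
  have hBne : ∀ i, (B i).Nonempty := fun i => card_pos.1 (by rw [hB]; fin_cases i <;> simp)
  have hCne : ∀ i, (C i).Nonempty := fun i => card_pos.1 (by rw [hC]; fin_cases i <;> simp)
  have hd₁0 : d₁ ≠ 0 := by rintro rfl; exact hd₁ (by rw [nsmul_zero])
  have he₁0 : e₁ ≠ 0 := by rintro rfl; exact he₁ (by rw [nsmul_zero])
  have hd₂0 : d₂ ≠ 0 := by rintro rfl; exact hd₂ (by rw [nsmul_zero])
  have he₂0 : e₂ ≠ 0 := by rintro rfl; exact he₂ (by rw [nsmul_zero])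
  have hδ₂0 : δ₂ ≠ 0 := by rintro rfl; exact hδ₂ (by rw [nsmul_zero])
  -- (1) cross steps
  have hcr : e₂ = d₁ ∨ e₂ = -d₁ := cross_steps_223_332_332 hS hA hB hC (i := 1) (j := 2) (by decide) (by decide) (by decide) hd₁ he₂ hA1 hY1 hB2 hZ2
  have hcr' : e₁ = d₂ ∨ e₁ = -d₂ := cross_steps_223_332_332 hS hA hB hC (i := 2) (j := 1) (by decide) (by decide) (by decide) hd₂ he₁ hA2 hY2 hB1 hZ1
  have hde : d₂ = e₁ ∨ d₂ = -e₁ := by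
    rcases hcr' with h | h
    · exact Or.inl h.symm
    · exact Or.inr (by rw [h, neg_neg])
  -- unpack the sets
  obtain ⟨a₁, ha₁⟩ := hA1; obtain ⟨b₁, hb₁⟩ := hB1; obtain ⟨a₂, ha₂⟩ := hA2; obtain ⟨b₂, hb₂⟩ := hB2; obtain ⟨c₂, hc₂⟩ := hC2
  have hA13 : #(A 1) = 3 := by rw [hA]; rfl
  have hB13 : #(B 1) = 3 := by rw [hB]; rfl
  have hA23 : #(A 2) = 3 := by rw [hA]; rfl
  have hB23 : #(B 2) = 3 := by rw [hB]; rfl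
  have hC22 : #(C 2) = 2 := by rw [hC]; rfl
  rw [hA13] at ha₁; rw [hB13] at hb₁; rw [hA23] at ha₂; rw [hB23] at hb₂; rw [hC22] at hc₂
  obtain ⟨t, ht⟩ := hY1; obtain ⟨r, hr⟩ := hZ1; obtain ⟨s, hs⟩ := hX2
  have hT12 : #(DU B C (univ.erase 1)) = 12 := by rw [card_DU_BC hS hAne]; simp only [hB, hC]; decide
  have hR12 : #(DU A C (univ.erase 1)) = 12 := by rw [card_DU_AC hS hBne]; simp only [hA, hC]; decide
  have hS13 : #(DU A B (univ.erase 2)) = 13 := by rw [card_DU_AB hS hCne]; simp only [hA, hB]; decide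
  rw [hT12] at ht; rw [hR12] at hr; rw [hS13] at hs
  have h2T : (2 : Fin 3) ∈ univ.erase 1 := by decide
  have h1S : (1 : Fin 3) ∈ univ.erase 2 := by decide
  have subT : D B C 2 ⊆ apFinset t d₁ 12 := fun x hx => by rw [← ht]; exact Finset.mem_biUnion.2 ⟨2, h2T, hx⟩
  have subR : D A C 2 ⊆ apFinset r e₁ 12 := fun x hx => by rw [← hr]; exact Finset.mem_biUnion.2 ⟨2, h2T, hx⟩
  have subS : D A B 1 ⊆ apFinset s δ₂ 13 := fun x hx => by rw [← hs]; exact Finset.mem_biUnion.2 ⟨1, h1S, hx⟩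
  -- elements
  have mA1 : ∀ i < 3, a₁ + i • d₁ ∈ A 1 := fun i hi => by rw [ha₁]; exact mem_apFinset_of_lt hi
  have mB1 : ∀ j < 3, b₁ + j • e₁ ∈ B 1 := fun j hj => by rw [hb₁]; exact mem_apFinset_of_lt hj
  have mA2 : ∀ i < 3, a₂ + i • d₂ ∈ A 2 := fun i hi => by rw [ha₂]; exact mem_apFinset_of_lt hi
  have mB2 : ∀ j < 3, b₂ + j • e₂ ∈ B 2 := fun j hj => by rw [hb₂]; exact mem_apFinset_of_lt hj
  have mC2 : ∀ ε < 2, c₂ + ε • δ₂ ∈ C 2 := fun ε hε => by rw [hc₂]; exact mem_apFinset_of_lt hε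
  have c0 : c₂ ∈ C 2 := by have := mC2 0 (by norm_num); rwa [zero_nsmul, add_zero] at this
  have c1 : c₂ + δ₂ ∈ C 2 := by have := mC2 1 (by norm_num); rwa [one_nsmul] at this
  have b0 : b₂ ∈ B 2 := by have := mB2 0 (by norm_num); rwa [zero_nsmul, add_zero] at this
  have b1' : b₂ + e₂ ∈ B 2 := by have := mB2 1 (by norm_num); rwa [one_nsmul] at this
  have b2' : b₂ + 2 • e₂ ∈ B 2 := mB2 2 (by norm_num)
  have a0 : a₂ ∈ A 2 := by have := mA2 0 (by norm_num); rwa [zero_nsmul, add_zero] at this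
  have a1' : a₂ + d₂ ∈ A 2 := by have := mA2 1 (by norm_num); rwa [one_nsmul] at this
  have a2' : a₂ + 2 • d₂ ∈ A 2 := mA2 2 (by norm_num)
  -- (2) δ₂ = ±k₂ d₁ from the grid Y₂ ⊆ T₁
  obtain ⟨g0, g1, g2⟩ := ap3_mem_D (E := B) (F := C) (j := 2) hb₂ c0
  obtain ⟨g0', g1', g2'⟩ := ap3_mem_D (E := B) (F := C) (j := 2) hb₂ c1
  have eY : c₂ + δ₂ - (b₂ + 2 • e₂) = c₂ - (b₂ + 2 • e₂) + δ₂ := by abel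
  rw [eY] at g0' g1' g2'
  have hk₂ := grid_step_bounds (y := c₂ - (b₂ + 2 • e₂)) hd₁ hcr (subT g0) (subT g1) (subT g2) (subT g0') (subT g1') (subT g2') hδ₂0
    (fun h => he₂0 (by
      have := (DBC_inj hS (hAne 2) b1' b0 c1 c0 (by rw [h]; abel)).1
      have e : e₂ = (b₂ + e₂) - b₂ := by abel
      rw [e, this, sub_self]))
    (fun h => he₂ (by
      have := (DBC_inj hS (hAne 2) b2' b0 c1 c0 (by rw [h, two_nsmul]; abel)).1
      have e : 2 • e₂ = (b₂ + 2 • e₂) - b₂ := by abel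
      rw [e, this, sub_self]))
    (fun h => he₂0 (by
      have := (DBC_inj hS (hAne 2) b0 b1' c1 c0 (by rw [h]; abel)).1
      have e : e₂ = (b₂ + e₂) - b₂ := by abel
      rw [e, ← this, sub_self]))
    (fun h => he₂ (by
      have := (DBC_inj hS (hAne 2) b0 b2' c1 c0 (by rw [h, two_nsmul]; abel)).1
      have e : 2 • e₂ = (b₂ + 2 • e₂) - b₂ := by abel
      rw [e, ← this, sub_self]))
  obtain ⟨k₂, hk3, hk9, hk₂⟩ := hk₂
  -- (3) δ₂ = ±k₂' e₁ from the grid Z₂ ⊆ R₁ (rows of step d₂ = ±e₁)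
  obtain ⟨z0, z1, z2⟩ := ap3_mem_D (E := A) (F := C) (j := 2) ha₂ c0
  obtain ⟨z0', z1', z2'⟩ := ap3_mem_D (E := A) (F := C) (j := 2) ha₂ c1
  have eZ : c₂ + δ₂ - (a₂ + 2 • d₂) = c₂ - (a₂ + 2 • d₂) + δ₂ := by abel
  rw [eZ] at z0' z1' z2'
  have hk₂' := grid_step_bounds (y := c₂ - (a₂ + 2 • d₂)) he₁ hde (subR z0) (subR z1) (subR z2) (subR z0') (subR z1') (subR z2') hδ₂0
    (fun h => hd₂0 (by
      have := (DAC_inj hS (hBne 2) a1' a0 c1 c0 (by rw [h]; abel)).1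
      have e : d₂ = (a₂ + d₂) - a₂ := by abel
      rw [e, this, sub_self]))
    (fun h => hd₂ (by
      have := (DAC_inj hS (hBne 2) a2' a0 c1 c0 (by rw [h, two_nsmul]; abel)).1
      have e : 2 • d₂ = (a₂ + 2 • d₂) - a₂ := by abel
      rw [e, this, sub_self]))
    (fun h => hd₂0 (by
      have := (DAC_inj hS (hBne 2) a0 a1' c1 c0 (by rw [h]; abel)).1
      have e : d₂ = (a₂ + d₂) - a₂ := by abel
      rw [e, ← this, sub_self]))
    (fun h => hd₂ (by
      have := (DAC_inj hS (hBne 2) a0 a2' c1 c0 (by rw [h, two_nsmul]; abel)).1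
      have e : 2 • d₂ = (a₂ + 2 • d₂) - a₂ := by abel
      rw [e, ← this, sub_self]))
  obtain ⟨k₂', hk3', hk9', hk₂'⟩ := hk₂'
  -- (4) X₁ ⊆ S₂: rows and columns
  have mX : ∀ i < 3, ∀ j < 3, (b₁ + j • e₁) - (a₁ + i • d₁) ∈ apFinset s δ₂ 13 :=
    fun i hi j hj => subS (mem_D.2 ⟨a₁ + i • d₁, mA1 i hi, b₁ + j • e₁, mB1 j hj, rfl⟩)
  set x₀ := b₁ - a₁ with hx₀def
  have row0 : x₀ ∈ apFinset s δ₂ 13 := by have := mX 0 (by norm_num) 0 (by norm_num); simpa only [zero_nsmul, add_zero] using this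
  have row1 : x₀ + e₁ ∈ apFinset s δ₂ 13 := by
    have := mX 0 (by norm_num) 1 (by norm_num); rw [zero_nsmul, add_zero, one_nsmul] at this; convert this using 1; rw [hx₀def]; abel
  have row2 : x₀ + e₁ + e₁ ∈ apFinset s δ₂ 13 := by
    have := mX 0 (by norm_num) 2 (by norm_num); rw [zero_nsmul, add_zero, two_nsmul] at this; convert this using 1; rw [hx₀def]; abel
  obtain ⟨u, hu1, hu6, hu⟩ := step_of_ap3_subset_13 hδ₂ he₁0 row0 row1 row2
  have col0 : x₀ - d₁ - d₁ ∈ apFinset s δ₂ 13 := by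
    have := mX 2 (by norm_num) 0 (by norm_num); rw [zero_nsmul, add_zero, two_nsmul] at this; convert this using 1; rw [hx₀def]; abel
  have col1 : x₀ - d₁ - d₁ + d₁ ∈ apFinset s δ₂ 13 := by
    have := mX 1 (by norm_num) 0 (by norm_num); rw [zero_nsmul, add_zero, one_nsmul] at this; convert this using 1; rw [hx₀def]; abel
  have col2 : x₀ - d₁ - d₁ + d₁ + d₁ ∈ apFinset s δ₂ 13 := by convert row0 using 1; abel
  obtain ⟨v, hv1, hv6, hv⟩ := step_of_ap3_subset_13 hδ₂ hd₁0 col0 col1 col2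
  -- (5) arithmetic
  have hvk := mult_cases hd₁ hv1 hv6 hk3 hk9 hv hk₂
  have huk := mult_cases he₁ hu1 hu6 hk3' hk9' hu hk₂'
  have hv36 : 3 ≤ v ∧ v ≤ 6 := by rcases hvk with ⟨h, -⟩ | ⟨h, -⟩ | ⟨h, -⟩ | ⟨h, -⟩ <;> omega
  have hu36 : 3 ≤ u ∧ u ≤ 6 := by rcases huk with ⟨h, -⟩ | ⟨h, -⟩ | ⟨h, -⟩ | ⟨h, -⟩ <;> omega
  by_cases huv : u = v
  · -- e₁ = ±d₁ contradicts the TPP of block 1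
    subst huv
    have hed : e₁ = d₁ ∨ e₁ = -d₁ := by
      rcases hu with hu | hu <;> rcases hv with hv | hv
      · exact Or.inl (by rw [hu, hv])
      · exact Or.inr (by rw [hu, hv, neg_neg])
      · exact Or.inr (by rw [hu, hv])
      · exact Or.inl (by rw [hu, hv])
    have a10 : a₁ ∈ A 1 := by have := mA1 0 (by norm_num); rwa [zero_nsmul, add_zero] at this
    have a11 : a₁ + d₁ ∈ A 1 := by have := mA1 1 (by norm_num); rwa [one_nsmul] at this
    have b10 : b₁ ∈ B 1 := by have := mB1 0 (by norm_num); rwa [zero_nsmul, add_zero] at this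
    have b11 : b₁ + e₁ ∈ B 1 := by have := mB1 1 (by norm_num); rwa [one_nsmul] at this
    have ed : d₁ = (a₁ + d₁) - a₁ := by abel
    rcases hed with h | h
    · have h1 := (DAB_inj hS (hCne 1) a11 a10 b11 b10 (by rw [h]; abel)).1
      apply hd₁0; rw [ed, h1, sub_self]
    · have h1 := (DAB_inj hS (hCne 1) a10 a11 b11 b10 (by rw [h]; abel)).1
      apply hd₁0; rw [ed, ← h1, sub_self]
  · -- the 3 × 3 grid does not fit in the 13-window
    obtain ⟨l₀, hl₀, hxl₀⟩ := mem_apFinset.1 row0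
    -- sign flags
    have hsu : ∃ su : Bool, if su then e₁ = -(u • δ₂) else e₁ = u • δ₂ := by
      rcases hu with h | h
      · exact ⟨false, by simpa using h⟩
      · exact ⟨true, by simpa using h⟩
    have hsv : ∃ sv : Bool, if sv then d₁ = -(v • δ₂) else d₁ = v • δ₂ := by
      rcases hv with h | h
      · exact ⟨false, by simpa using h⟩
      · exact ⟨true, by simpa using h⟩
    obtain ⟨su, hsu⟩ := hsu
    obtain ⟨sv, hsv⟩ := hsv
    refine window_dead_int l₀ hl₀ u (by omega) hu36.1 v (by omega) hv36.1 huv su sv ?_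
    intro i hi j hj
    have hmem : x₀ + j • e₁ - i • d₁ ∈ apFinset s δ₂ 13 := by
      have := mX i hi j hj; convert this using 1; rw [hx₀def]; abel
    obtain ⟨l, hl, hxl⟩ := mem_apFinset.1 hmem
    refine ⟨l, hl, ?_⟩
    have hrel := window_rel su sv hxl₀ hxl hsu hsv
    have hL : l + (if sv then 0 else i * v) + (if su then j * u else 0) < 40 := by
      have : i * v ≤ 12 := le_trans (Nat.mul_le_mul (by omega : i ≤ 2) hv36.2) (by norm_num)
      have : j * u ≤ 12 := le_trans (Nat.mul_le_mul (by omega : j ≤ 2) hu36.2) (by norm_num)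
      cases su <;> cases sv <;> simp <;> omega
    have hR : l₀ + (if su then 0 else j * u) + (if sv then i * v else 0) < 40 := by
      have : i * v ≤ 12 := le_trans (Nat.mul_le_mul (by omega : i ≤ 2) hv36.2) (by norm_num)
      have : j * u ≤ 12 := le_trans (Nat.mul_le_mul (by omega : j ≤ 2) hu36.2) (by norm_num)
      cases su <;> cases sv <;> simp <;> omega
    exact nsmul_eq_nsmul_40 δ₂ hδ₂ _ hL _ hR hrel

end Summit.MatrixMultiplication.OmegaCensus.Z46
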